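/-
b2b-lace packet, TAIL-BOUND ANALYST gen 11 (unit `b2b-lace-tail-g11`).  (S2b)-IMPR TABLE-SIDE KIT (T9, typed on standing
offer): the SUPPORT-SIZE REGIONS `R_s = {x : s ≤ #supp x}` of [HS92b] Lemma B.4 / [NoBLE17] §5.1 for every `W_d`-invariant
sorted-antitone table majorant (`W_{n,j}`, `L_n`, hence `K`, `U`, `T`), the invariance of `#supp` under `W_d`, and the
inclusions of the cones of `2e₁+e₂` / `e₁+e₂+e₃` in `R₂` / `R₃`.  `d`-generic; additive; no numeral of any dimension.
-/
import Literature.Probability.FitznerVanDerHofstad2017.SrwIntegralTUCellSup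
import Literature.Probability.FitznerVanDerHofstad2017.SrwIntegralIShiftNearNodes
import HarnessLib

/-!
# Support-size regions: `F x ≤ max_{s ≤ r ≤ d} F(1^r)` on `{s ≤ #supp x}` for sorted-antitone `F`

CITATION HEADER (PLACEMENT v2). Part of a certified REPRODUCTION of R. Fitzner, R. van der Hofstad,
*Generalized approach to the non-backtracking lace expansion*, Probab. Theory Related Fields **169** (2017)
1041–1119 [NoBLE17] (§5.1 p. 1093, the evaluation of the SRW-integral majorants at the lowest-order shapes; (5.9),
(5.11) pp. 1091–1092; (5.28)–(5.29) p. 1093) and of T. Hara, G. Slade, *The lace expansion for self-avoiding walk in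
five or more dimensions*, Rev. Math. Phys. **4** (1992) 235–327 [HS92b] (App. B, Lemma B.4: monotonicity in the sorted
order, whence a sorted non-negative vector with support size `r` is `1^r + z`, `z` sorted non-negative).  Origin: build
`lace` (b2b), the `(S2b)-IMPR` leaf — the far cell `Q` read cone by cone (`F3BoundsQCones`, `SrwIntegralSortedCones`)
and the shell cell `𝒳` read at its nodes (`F3BoundsCellSplit`), where the off-axis cones and the shell point `e₁+e₂`
are served by ONE family of x-generic region bounds on `R₂ ⊇ absCone(2e₁+e₂) ∋ e₁+e₂` and `R₃ ⊇ absCone(e₁+e₂+e₃)`.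

## Contents (generic `d`; every theorem proved)

§0 `suppCount_spAct` (`#supp` is `W_d`-invariant); `le_suppCount_of_dominates_classVec` (`|x_j| ≥ 1` for `j < s` ⇒
   `s ≤ #supp x`, by the injection `Fin s ↪ supp x`, no sorting), and its instances for the cones of `2e₁+e₂` (`2 ≤ #supp`)
   and `e₁+e₂+e₃` (`3 ≤ #supp`);
§1 abstract `F` (`SpInvariant`, `SortedAntitone`): `le_of_onesBounds_of_le_suppCount` — on `R_s`, `F x ≤ B` whenever
   `F(1^r) ≤ B` for `s ≤ r ≤ d` (sort `x` inside `W_d`, keep `#supp`, apply `le_classVec_suppCount_of_antitone`);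
§2 `W_{n,j}`, `L_n` on `R_s`; §3 `K_{n,m+j} ≤ √I_{n,2m}(0)·√B` on `R_s`; §4 `U_{n,l} ≤ √V'·√B` on `R_s` ((5.9));
§5 `T_{n,l}` on `R_s` (rules `4/d`, `2/d` of (5.11)); §6 the `T*`-slot `TS_{m,l} ≤ A₁ + min((4/d)A₀, (2/d)A₀')` on any set
   from `K`-bounds on that set ((5.11) with `α̲_F ≥ 1`).

No dimension, no table, no numeric value; the node VALUES `F(1^r)` are the business of the certifying table modules.

## References
* [NoBLE17] R. Fitzner, R. van der Hofstad, PTRF 169 (2017) 1041–1119; arXiv:1506.07969 — §5.1 p. 1093, (5.9), (5.11)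
  pp. 1091–1092, (5.28)–(5.29) p. 1093; notebook `SRW.nb` §2 (arXiv:1506.07977 anc).
* [HS92b] T. Hara, G. Slade, Rev. Math. Phys. 4 (1992) 235–327, App. B, Lemma B.4.
-/

namespace Literature.Probability.FitznerVanDerHofstad2017

open Finset Real

variable {d : ℕ}

/-! ### §0  Support size: `W_d`-invariance and the cone inclusions -/

/-- `#supp` is invariant under signed permutations: `#supp p(x; ν, δ) = #supp x`.
[cite: FitznerVanDerHofstad2016NoBLE, Def. 2.5 p. 1058] -/
theorem suppCount_spAct (τ : SgnPermPair d) (x : Fin d → ℤ) : suppCount (spAct τ x) = suppCount x := by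
  classical
  unfold suppCount
  have h1 : (univ.filter fun i : Fin d => spAct τ x i ≠ 0) =
      (univ.filter fun j : Fin d => x j ≠ 0).map τ.1.symm.toEmbedding := by
    ext i
    simp only [Finset.mem_filter, Finset.mem_univ, true_and, Finset.mem_map_equiv, Equiv.symm_symm,
      spAct_apply]
    exact ⟨fun h => (mul_ne_zero_iff.mp h).2, fun h => mul_ne_zero (Units.ne_zero _) h⟩
  rw [h1, Finset.card_map]

/-- **Cone of `1^s` ⊆ `R_s`.**  If `|x_j| ≥ 1` for every `j < s` (`s ≤ d`), i.e. `x` dominates `1^s = classVec d s 0`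
coordinatewise, then `s ≤ #supp x` (the first `s` coordinates inject into the support): the upper cone of the shape `1^s` lies in the
support-size region `R_s`. [cite: FitznerVanDerHofstad2016NoBLE, §5.1 p. 1093] -/
theorem le_suppCount_of_dominates_classVec {s : ℕ} (hsd : s ≤ d) {x : Fin d → ℤ}
    (hx : ∀ j, classVec d s 0 j ≤ |x j|) : s ≤ suppCount x := by
  classical
  unfold suppCount
  let ι : Fin s ↪ Fin d := ⟨Fin.castLE hsd, Fin.castLE_injective hsd⟩
  calc s = ((univ : Finset (Fin s)).map ι).card := by
        rw [Finset.card_map, Finset.card_univ, Fintype.card_fin]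
    _ ≤ (univ.filter fun μ : Fin d => x μ ≠ 0).card := by
        refine Finset.card_le_card fun μ hμ => ?_
        rw [Finset.mem_map] at hμ
        obtain ⟨i, -, rfl⟩ := hμ
        simp only [Finset.mem_filter, Finset.mem_univ, true_and]
        have h := hx (Fin.castLE hsd i)
        rw [classVec_zero_right_apply, if_pos (by rw [Fin.val_castLE]; exact i.2)] at h
        intro h0
        change x (Fin.castLE hsd i) = 0 at h0
        rw [h0, abs_zero] at h
        exact absurd h (by norm_num)

/-- The cone of `2e₁+e₂` lies in `R₂ = {2 ≤ #supp}` (`d ≥ 2`). [cite: FitznerVanDerHofstad2016NoBLE, §5.1 p. 1093] -/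
theorem two_le_suppCount_of_dominates_two_one (hd : 2 ≤ d) {x : Fin d → ℤ}
    (hx : ∀ j, vecOfParts d [2, 1] j ≤ |x j|) : 2 ≤ suppCount x :=
  le_suppCount_of_dominates_classVec hd fun j => le_trans (by
    rw [classVec_zero_right_apply, vecOfParts_pair_apply]
    split_ifs <;> omega) (hx j)

/-- The cone of `2e₁+2e₂` lies in `R₂ = {2 ≤ #supp}` (`d ≥ 2`). [cite: FitznerVanDerHofstad2016NoBLE, §5.1 p. 1093] -/
theorem two_le_suppCount_of_dominates_two_two (hd : 2 ≤ d) {x : Fin d → ℤ}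
    (hx : ∀ j, vecOfParts d [2, 2] j ≤ |x j|) : 2 ≤ suppCount x :=
  le_suppCount_of_dominates_classVec hd fun j => le_trans (by
    rw [classVec_zero_right_apply, vecOfParts_pair_apply]
    split_ifs <;> omega) (hx j)

/-- The cone of `e₁+e₂+e₃` lies in `R₃ = {3 ≤ #supp}` (`d ≥ 3`). [cite: FitznerVanDerHofstad2016NoBLE, §5.1 p. 1093] -/
theorem three_le_suppCount_of_dominates_one_one_one (hd : 3 ≤ d) {x : Fin d → ℤ}
    (hx : ∀ j, vecOfParts d [1, 1, 1] j ≤ |x j|) : 3 ≤ suppCount x :=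
  le_suppCount_of_dominates_classVec hd fun j => by rw [classVec_three_zero_eq_vecOfParts]; exact hx j

/-- The shell node `e₁+e₂ = classVec d 2 0` lies in `R₂` (`d ≥ 2`). [cite: FitznerVanDerHofstad2016NoBLE, §5.1 p. 1093] -/
theorem two_le_suppCount_classVec_two (hd : 2 ≤ d) : 2 ≤ suppCount (classVec d 2 0) :=
  le_suppCount_of_dominates_classVec hd fun _ => le_abs_self _

/-! ### §1  Abstract `F`: the support-size regions -/

/-- **Region `R_s = {s ≤ #supp x}`.**  For `F` `W_d`-invariant and sorted-antitone: if `F(1^r) ≤ B` for all `s ≤ r ≤ d`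
then `F x ≤ B` for every `x` with `s ≤ #supp x` — sort `|x|` inside `W_d` (support size is kept), and a sorted
non-negative vector of support size `r` is `1^r + z` with `z` sorted non-negative ([HS92b] B.4).
[cite: HaraSlade1992b, App. B, Lemma B.4] [cite: FitznerVanDerHofstad2016NoBLE, §5.1 p. 1093] -/
theorem le_of_onesBounds_of_le_suppCount (F : (Fin d → ℤ) → ℝ) (hI : SpInvariant F) (hF : SortedAntitone F)
    {s : ℕ} (B : ℝ) (hB : ∀ r : ℕ, s ≤ r → r ≤ d → F (classVec d r 0) ≤ B)
    (x : Fin d → ℤ) (hx : s ≤ suppCount x) : F x ≤ B := by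
  obtain ⟨τ, hanti, hy0, -, -⟩ := exists_spAct_sorted x
  rw [← hI τ x]
  refine (le_classVec_suppCount_of_antitone F hF _ hanti hy0).trans (hB _ ?_ (suppCount_le _))
  rw [suppCount_spAct]
  exact hx

/-! ### §2  `W_{n,j}` and `L_n` on `R_s` -/

/-- `W_{n,j} x ≤ max_{s ≤ r ≤ d} W_{n,j}(1^r)` on `{s ≤ #supp x}` (`n ≥ 1`, `d ≥ 2n+1`).
[cite: FitznerVanDerHofstad2016NoBLE, §5.1 p. 1093; HaraSlade1992b, App. B, Lemma B.4] -/
theorem srwW_le_of_le_suppCount {n : ℕ} (hn : 1 ≤ n) (hd : 2 * n + 1 ≤ d) (j : ℕ) {s : ℕ} (B : ℝ)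
    (hB : ∀ r : ℕ, s ≤ r → r ≤ d → srwW d n j (classVec d r 0) ≤ B)
    (x : Fin d → ℤ) (hx : s ≤ suppCount x) : srwW d n j x ≤ B :=
  le_of_onesBounds_of_le_suppCount _ (spInvariant_srwW n j) (sortedAntitone_srwW hn hd j) B hB x hx

/-- `L_n x ≤ max_{s ≤ r ≤ d} L_n(1^r)` on `{s ≤ #supp x}` (`n ≥ 1`, `d ≥ 2n+1`).
[cite: FitznerVanDerHofstad2016NoBLE, §5.1 p. 1093; HaraSlade1992b, App. B, Lemma B.4] -/
theorem srwL_le_of_le_suppCount {n : ℕ} (hn : 1 ≤ n) (hd : 2 * n + 1 ≤ d) {s : ℕ} (B : ℝ)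
    (hB : ∀ r : ℕ, s ≤ r → r ≤ d → srwL d n (classVec d r 0) ≤ B)
    (x : Fin d → ℤ) (hx : s ≤ suppCount x) : srwL d n x ≤ B :=
  le_of_onesBounds_of_le_suppCount _ (spInvariant_srwL n) (sortedAntitone_srwL hn hd) B hB x hx

/-! ### §3  `K_{n,m+j} ≤ √I_{n,2m}(0) · √B` on `R_s` (the `W`-split (5.28)–(5.29)) -/

/-- `K` on `{s ≤ #supp x}` from the nodes `1^r (s ≤ r ≤ d)` of `W_{n,j}`.
[cite: FitznerVanDerHofstad2016NoBLE, (5.28)–(5.29) p. 1093, §5.1 p. 1093] -/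
theorem srwK_le_of_le_suppCount {n : ℕ} (hn : 1 ≤ n) (hd : 2 * n + 1 ≤ d) (m j : ℕ) {s : ℕ} (B : ℝ)
    (hB : ∀ r : ℕ, s ≤ r → r ≤ d → srwW d n j (classVec d r 0) ≤ B)
    (x : Fin d → ℤ) (hx : s ≤ suppCount x) :
    srwK d n (m + j) x ≤ Real.sqrt (srwI d n (2 * m) 0) * Real.sqrt B :=
  srwK_le_sqrt_of_srwW_le hd m j x (srwW_le_of_le_suppCount hn hd j B hB x hx)

/-! ### §4  `U_{n,l} ≤ √V' · √B` on `R_s` ((5.9) through `L_n`) -/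

/-- `U` on `{s ≤ #supp x}` from the nodes `1^r (s ≤ r ≤ d)` of `L_n`.
[cite: FitznerVanDerHofstad2016NoBLE, (5.9) p. 1091, §5.1 p. 1093] -/
theorem srwU_le_of_le_suppCount {n : ℕ} (hn : 1 ≤ n) (hd : 2 * n + 1 ≤ d) (l : ℕ) {s : ℕ} {V' B : ℝ}
    (hV : srwV d n (2 * l) ≤ V') (hB : ∀ r : ℕ, s ≤ r → r ≤ d → srwL d n (classVec d r 0) ≤ B)
    (x : Fin d → ℤ) (hx : s ≤ suppCount x) : srwU d n l x ≤ Real.sqrt V' * Real.sqrt B :=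
  srwU_le_sqrt_of_le hd l x hV (srwL_le_of_le_suppCount hn hd B hB x hx)

/-! ### §5  `T_{n,l}` on `R_s` ((5.11) through `K`) -/

/-- `T` on `{s ≤ #supp x}`, rule `4/d`: splits `l + 1 = m₁ + j₁`, `l = m₀ + j₀`, nodes `1^r (s ≤ r ≤ d)` of `W_{n,j₁}`, `W_{n,j₀}`.
[cite: FitznerVanDerHofstad2016NoBLE, (5.11) p. 1092, §5.1 p. 1093] -/
theorem srwT_le_of_le_suppCount_four {n : ℕ} (hn : 1 ≤ n) (hd : 2 * n + 1 ≤ d) {l m₁ j₁ m₀ j₀ : ℕ}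
    (hl1 : m₁ + j₁ = l + 1) (hl0 : m₀ + j₀ = l) {s : ℕ} (B₁ B₀ : ℝ)
    (hB1 : ∀ r : ℕ, s ≤ r → r ≤ d → srwW d n j₁ (classVec d r 0) ≤ B₁)
    (hB0 : ∀ r : ℕ, s ≤ r → r ≤ d → srwW d n j₀ (classVec d r 0) ≤ B₀)
    (x : Fin d → ℤ) (hx : s ≤ suppCount x) :
    srwT d n l x ≤ Real.sqrt (srwI d n (2 * m₁) 0) * Real.sqrt B₁ +
      4 / d * (Real.sqrt (srwI d n (2 * m₀) 0) * Real.sqrt B₀) := by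
  have h1 := srwK_le_of_le_suppCount hn hd m₁ j₁ B₁ hB1 x hx
  have h0 := srwK_le_of_le_suppCount hn hd m₀ j₀ B₀ hB0 x hx
  rw [hl1] at h1
  rw [hl0] at h0
  exact srwT_le_of_srwK_le_four hd l x h1 h0

/-- `T` on `{s ≤ #supp x}`, rule `2/d` (`d ≥ 2(n+1)+1`): nodes `1^r (s ≤ r ≤ d)` of `W_{n,j₁}` and of `W_{n+1,j₀}`.
[cite: FitznerVanDerHofstad2016NoBLE, (5.11) p. 1092, §5.1 p. 1093] -/
theorem srwT_le_of_le_suppCount_two {n : ℕ} (hn : 1 ≤ n) (hd : 2 * (n + 1) + 1 ≤ d) {l m₁ j₁ m₀ j₀ : ℕ}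
    (hl1 : m₁ + j₁ = l + 1) (hl0 : m₀ + j₀ = l) {s : ℕ} (B₁ B₀ : ℝ)
    (hB1 : ∀ r : ℕ, s ≤ r → r ≤ d → srwW d n j₁ (classVec d r 0) ≤ B₁)
    (hB0 : ∀ r : ℕ, s ≤ r → r ≤ d → srwW d (n + 1) j₀ (classVec d r 0) ≤ B₀)
    (x : Fin d → ℤ) (hx : s ≤ suppCount x) :
    srwT d n l x ≤ Real.sqrt (srwI d n (2 * m₁) 0) * Real.sqrt B₁ +
      2 / d * (Real.sqrt (srwI d (n + 1) (2 * m₀) 0) * Real.sqrt B₀) := by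
  have h1 := srwK_le_of_le_suppCount hn (by omega) m₁ j₁ B₁ hB1 x hx
  have h0 := srwK_le_of_le_suppCount (by omega) hd m₀ j₀ B₀ hB0 x hx
  rw [hl1] at h1
  rw [hl0] at h0
  exact srwT_le_of_srwK_le_two hd l x h1 h0

/-! ### §6  The `T*`-slot on a set from `K`-bounds on the set ((5.11), `α̲_F ≥ 1`) -/

/-- **`TS_{m,l} ≤ A₁ + min((4/d)A₀, (2/d)A₀')` on a set `C`** from `K_{m,l+1} ≤ A₁`, `K_{m,l} ≤ A₀`, `K_{m+1,l} ≤ A₀'` on `C`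
(`d ≥ 2m+3`, `1 ≤ a = α̲_F`): (5.11) read on `C` (a region `R_s`, a cone, a point).
[cite: FitznerVanDerHofstad2016NoBLE, §5.2 (5.11) p. 1092; §3.3.5 (3.72) p. 1077] -/
theorem srwTS_le_on_of_srwK_le {m : ℕ} (hm : 2 * (m + 1) + 1 ≤ d) {a : ℝ} (ha : 1 ≤ a) (l : ℕ)
    (C : Set (Fin d → ℤ)) {A₁ A₀ A₀' : ℝ}
    (h1 : ∀ x ∈ C, srwK d m (l + 1) x ≤ A₁) (h0 : ∀ x ∈ C, srwK d m l x ≤ A₀)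
    (h0' : ∀ x ∈ C, srwK d (m + 1) l x ≤ A₀') :
    ∀ x ∈ C, srwTS d a m l x ≤ A₁ + min (4 / d * A₀) (2 / d * A₀') := fun x hx =>
  (srwTS_le_of_one_le hm ha l x).trans (add_le_add (h1 x hx)
    (min_le_min (mul_le_mul_of_nonneg_left (h0 x hx) (by positivity))
      (mul_le_mul_of_nonneg_left (h0' x hx) (by positivity))))

end Literature.Probability.FitznerVanDerHofstad2017
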